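import Summits.QuantumFields.YangMills.Theorems.UnitScaleTiltProp7NestedMeanTowerClosenessPlug
import Summits.QuantumFields.YangMills.Theorems.UnitScaleTiltProp7NSIntertwinerOfRecord
import HarnessLib

/-!
# Route `UnitScaleTilt`, crux «MinimiserStabilityRegPr» (stmt-QuantumFields-19200, stub EX), positivity block, the LOD ∕ Combes–Thomas line of ★p1 g24's
# `LOCATE-P349-CT` (★★OWNER RULING №33) — **BRICK (L1) «BLOCK COVARIANT POINCARÉ ON `ker Q″`» IS ALREADY A TREE THEOREM: for EVERY top nested covariant mean `Q″` OF RECORD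
# (clauses (iii)+(iv) of ✓`Prop7NSIntertwinerOfRecord.exists_intertwiner_of_regPr`) and every printed-regular background, `Q″(λ) = 0 ⟹ ‖λ‖² ≤ 2·‖D^η_{U₀} λ‖²` —
# `c_P² = ½`, FREE of `L`, of `k = K − n`, of the torus** (EX namer ∕ positivity-book holder w2 g11, 2026-08-29; LOCATE-L1 of the book)

Cell `ym3-torus` (HUMAN RULING D-0037: YM₃ on T³ is ladder rung R3 — NOT d = 4, NOT infinite volume, NOT a mass gap, NOT Clay).  Width seat `ym-ust-19200-w2` (gen 11).
THEOREMS ONLY (0 `def`, 0 `sorry`); `--supports stmt-QuantumFields-19200 --as helper`, count-neutral; ONE knit BY NAME, no estimate of its own.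

THE POINT.  RULING №33 (2) names (L1) — a VOLUME-FREE block covariant Poincaré constant `c_P` on `ker Q″(U₀)` at every curved `U₀ ∈ 𝔘_k(ε₀)` — as «THE bet of the line» to be
typed FIRST.  It was typed on 2026-08-28 by the px20 ∕ px11 lineages for the (P2-core) plan: ✓`Prop7NestedMeanPoincare.normSq_toL2S_le_two_mul_of_ns_eq_zero` (the `ℓ²` block
Poincaré on the kernel of a REFERENCE mean, constant 2) with every tower-closeness row inhabited from `RegPr` alone by ✓`Prop7NestedMeanTowerCloseness*` (ROW-T), packaged as
✓`Prop7NestedMeanTowerCloseness.normSq_toL2S_le_two_mul_of_nsTop_eq_zero` (`…TowerClosenessPlug`): at `RegPr F n K ε₀ U₀`, `10⁷L³ε₀ ≤ 1`, for ANY averaging sequence `ns` of `l`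
(the recursion of ✓`QTwS_gaugeDir_of_avgSeq`, transports `holT (emlIterU j U₀♭) (emb y) (stairWord σ (off r))`) with `ns (K − n) = 0`: `‖toL2S l‖² ≤ 2·‖DL2 U₀ (toL2S l)‖²`.
The `Q″` of record is DEFINED by that recursion (✓`exists_intertwiner_of_regPr` (iii): every averaging sequence has top `Q″(toL2S λ)`; (iv): a sequence exists).  So the two
compose in fifteen lines: this file.  BOOK CONSEQUENCE: (L1) of the LOD line is CLOSED with `c_P² = ½` (weighted letters: `‖·‖ = ‖toL2S ·‖`, `D^η = DL2`); the line's risk moves to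
(L2) (member reading of (L0): block-locality of `proj_{ker Q″}`) and (L5) (local gauge + collar).

WHAT IS PROVED (ns `…Theorems.Prop7BlockPoincareKerTopMean`; T³ member `F`, `n ≤ K`, weight `c₀`).
* ★★★ `normSq_le_two_mul_normSq_DL2_of_topMean_eq_zero` — for ANY `ℂ`-linear `Q''` satisfying clauses (iii) («every averaging sequence of `λ` has top `Q'' (toL2S λ)`») and (iv)
  («an averaging sequence of `λ` exists») of ✓`exists_intertwiner_of_regPr` VERBATIM, at `RegPr F n K ε₀ U₀`, `0 < ε₀`, `10⁷L³ε₀ ≤ 1`: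
  `∀ λ, Q'' (toL2S λ) = 0 → ‖toL2S λ‖² ≤ 2·‖DL2 U₀ (toL2S λ)‖²`.
* ★★ `exists_topMean_blockPoincare_of_regPr` — the same packaged with the intertwiner of record: `∃ Q'' D'`, (i) `QL2 U₀ (DL2 U₀ l) = D' (Q'' l)` ∧ (v) `ker Q'' ≤ N_S(U₀)` ∧
  the Poincaré row on `ker Q''` (window `10¹²L³ε₀ ≤ 1` ⊇ both inputs' windows).
HONEST SCOPE.  A knit by name; the estimate is ✓`Prop7NestedMeanPoincare` + ROW-T's; nothing of (L0), (L2)–(L6), (3.49), Thm 3.3 ∕ 3.11, `h349`, `hGF`, EX or the crux is proved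
here; nothing continuum ∕ OS ∕ mass-gap ∕ Clay.

References: T. Bałaban, CMP **89** (1983) 571–597 [Balaban1983RegularityDecay] ((2.27) p.580, the block Poincaré inequality); CMP **99** (1985) 389–434
[Balaban1985BackgroundPropagators] ((3.3) p.391, (3.19) p.393, (3.114)–(3.115) p.418, Thm 3.11 p.416); CMP **98** (1985) 17–51 [Balaban1985Averaging] ((97) p.32).
-/

set_option autoImplicit false

noncomputable section

open scoped BigOperators Matrix.Norms.L2Operator

namespace Summit.QuantumFields.YangMills.Theorems.Prop7BlockPoincareKerTopMean

open Literature.MathematicalPhysics.QuantumFieldTheory.Balaban1983to89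
open T4Continuum BlockAveraging
open BlockAveraging (Idx)
open B7Prop1Explicit (disp)
open B10Eq27TorusAxialLog (holT transl)
open B7TransferAnalyticMean (meanCLM)
open B9Eq311L2Pairing (WL2)
open B11Eq103H1Complex (SiteL2K)
open T3ContinuumYM3Torus
open T3PrintedRegularMinimiser (RegPr)
open T3PrintedRegularOrbits (sites_eq)
open T3LevelShift (bondShift)
open T3SectALandauChart (eta bgUnits)
open Summit.QuantumFields.YangMills.Theorems.Prop8Chart (emlIterU)
open Summit.QuantumFields.YangMills.Theorems.Prop7SectET3Transport (periodsT3)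
open Summit.QuantumFields.YangMills.Theorems.Prop7SectET3HilbertLetters (W₂ toL2S toL2B QL2 DL2)
open Summit.QuantumFields.YangMills.Theorems.Prop7SectET3GaugeProjector (NS)
open Summit.QuantumFields.YangMills.Theorems.Prop7NestedMeanTowerCloseness (normSq_toL2S_le_two_mul_of_nsTop_eq_zero)
open Summit.QuantumFields.YangMills.Theorems.Prop7NSIntertwinerOfRecord (exists_intertwiner_of_regPr)

variable (F : T3Family) {n K : ℕ}

/-- ★★★ **(L1) — THE BLOCK COVARIANT POINCARÉ INEQUALITY ON `ker Q″` FOR ANY TOP NESTED COVARIANT MEAN `Q″` OF RECORD, FROM `RegPr` ALONE, CONSTANT 2.**  `Q''` is any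
`ℂ`-linear map with clauses (iii) and (iv) of ✓`exists_intertwiner_of_regPr` (every averaging sequence of `λ` — the `meanCLM` recursion with the stair transports of the
background tower — has top `Q'' (toL2S λ)`, and one exists); then `Q'' (toL2S λ) = 0 ⟹ ‖toL2S λ‖² ≤ 2·‖DL2 U₀ (toL2S λ)‖²`.  Proof: pick the sequence of (iv), its top is `0`,
apply ✓`normSq_toL2S_le_two_mul_of_nsTop_eq_zero`. [cite: Balaban1983RegularityDecay, (2.27) p.580; Balaban1985BackgroundPropagators, (3.114)–(3.115) p.418, Thm 3.11 p.416] -/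
theorem normSq_le_two_mul_normSq_DL2_of_topMean_eq_zero {c₀ : ℝ} [Fact (0 < c₀)] {ε₀ : ℝ} (hε₀ : 0 < ε₀) (hε7 : 10 ^ 7 * (F.L : ℝ) ^ 3 * ε₀ ≤ 1)
    (U₀ : GaugeField (F.P K) 0 (Matrix.specialUnitaryGroup (Fin 2) ℂ)) (hreg : RegPr F n K ε₀ U₀)
    (Q'' : SiteL2K ℂ 3 (periodsT3 F K) c₀ W₂ →ₗ[ℂ] (Site (F.P K) (K - n) → Matrix (Fin 2) (Fin 2) ℂ))
    (hseq : ∀ lam : Site (F.P K) 0 → Matrix (Fin 2) (Fin 2) ℂ, ∃ ns : (j : ℕ) → Site (F.P K) j → Matrix (Fin 2) (Fin 2) ℂ, ns 0 = lam ∧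
        (∀ (j : ℕ) (y : Site (F.P K) (j + 1)), ns (j + 1) y = ns j (emb y) - meanCLM (Idx (F.P K)) (Matrix (Fin 2) (Fin 2) ℂ) fun i : Idx (F.P K) =>
          ns j (emb y) - ((holT (emlIterU j (bgUnits F K U₀)) (emb y) (stairWord i.2.1 (off i.1)) : (Matrix (Fin 2) (Fin 2) ℂ)ˣ) : Matrix (Fin 2) (Fin 2) ℂ) *
            ns j (transl (emb y) (disp (stairWord i.2.1 (off i.1)))) * (((holT (emlIterU j (bgUnits F K U₀)) (emb y) (stairWord i.2.1 (off i.1)))⁻¹ : (Matrix (Fin 2) (Fin 2) ℂ)ˣ) : Matrix (Fin 2) (Fin 2) ℂ)) ∧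
        ns (K - n) = Q'' (toL2S F K c₀ lam)) :
    ∀ lam : Site (F.P K) 0 → Matrix (Fin 2) (Fin 2) ℂ, Q'' (toL2S F K c₀ lam) = 0 →
      ‖toL2S F K c₀ lam‖ ^ 2 ≤ 2 * ‖DL2 F n K c₀ U₀ (toL2S F K c₀ lam)‖ ^ 2 := by
  intro lam hlam
  obtain ⟨ns, h0, hsucc, htop⟩ := hseq lam
  exact normSq_toL2S_le_two_mul_of_nsTop_eq_zero F hε₀ hε7 U₀ hreg ns lam h0 hsucc (fun y => by rw [htop, hlam]; rfl)

/-- ★★ **THE INTERTWINER OF RECORD WITH ITS POINCARÉ ROW** — ✓`exists_intertwiner_of_regPr` re-packaged with (L1): at `RegPr F n K ε₀ U₀`, `10¹²L³ε₀ ≤ 1`, there are `Q''`, `D'`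
with (i) `Q_k(U₀)(D_{U₀}λ) = D'(Q''λ)`, (v) `ker Q'' ≤ N_S(U₀)`, and (L1) `Q''(toL2S λ) = 0 ⟹ ‖toL2S λ‖² ≤ 2‖DL2 U₀ (toL2S λ)‖²` — the three facts the LOD line's (V2)∕(V4) read
(`R_{Q″}` is print-shaped, dominated by `R_S`, and its `S` is accretive with a volume-free constant).
[cite: Balaban1985BackgroundPropagators, (3.114)–(3.115) p.418, (3.19) p.393, Thm 3.11 p.416; Balaban1983RegularityDecay, (2.27) p.580] -/
theorem exists_topMean_blockPoincare_of_regPr (h : n ≤ K) {c₀ : ℝ} [Fact (0 < c₀)] (cB : ℝ) {ε₀ : ℝ} (hε₀ : 0 < ε₀) (hWε : 10 ^ 12 * (F.L : ℝ) ^ 3 * ε₀ ≤ 1)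
    (U₀ : GaugeField (F.P K) 0 (Matrix.specialUnitaryGroup (Fin 2) ℂ)) (hreg : RegPr F n K ε₀ U₀) :
    ∃ (Q'' : SiteL2K ℂ 3 (periodsT3 F K) c₀ W₂ →ₗ[ℂ] (Site (F.P K) (K - n) → Matrix (Fin 2) (Fin 2) ℂ))
      (D' : (Site (F.P K) (K - n) → Matrix (Fin 2) (Fin 2) ℂ) →ₗ[ℂ] WL2 ℂ (fun _ : PBond (F.P n) 0 => cB) W₂),
      (∀ l, QL2 F n K h c₀ cB U₀ (DL2 F n K c₀ U₀ l) = D' (Q'' l)) ∧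
      LinearMap.ker Q'' ≤ NS F n K h c₀ cB U₀ ∧
      (∀ lam : Site (F.P K) 0 → Matrix (Fin 2) (Fin 2) ℂ, Q'' (toL2S F K c₀ lam) = 0 →
        ‖toL2S F K c₀ lam‖ ^ 2 ≤ 2 * ‖DL2 F n K c₀ U₀ (toL2S F K c₀ lam)‖ ^ 2) := by
  obtain ⟨Q'', D', hi, -, -, hiv, hv⟩ := exists_intertwiner_of_regPr F h (c₀ := c₀) cB hε₀ hWε U₀ hreg
  have hε7 : 10 ^ 7 * (F.L : ℝ) ^ 3 * ε₀ ≤ 1 := by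
    have hL : (0 : ℝ) ≤ (F.L : ℝ) ^ 3 * ε₀ := by positivity
    nlinarith
  exact ⟨Q'', D', hi, hv, normSq_le_two_mul_normSq_DL2_of_topMean_eq_zero F hε₀ hε7 U₀ hreg Q'' hiv⟩

end Summit.QuantumFields.YangMills.Theorems.Prop7BlockPoincareKerTopMean

end
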